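import Summits.FinalStateConjecture.FinalStateConjecture.Theorems.ExactKerrEndsCensorshipAlongKerrEndsCompactAccess
import Summits.FinalStateConjecture.FinalStateConjecture.Theorems.ExactKerrEndsCensorshipAlongKerrEndsWindowUpgrade
import HarnessLib

/-!
# Route `ExactKerrEnds`, crux `CensorshipAlongKerrEnds` (stmt-FinalStateConjecture-18521), line `Sketch` v4.2: RECORD —
# the two SMOOTH COMPACT exits (+ MGHD existence) already imply the SUMMIT STATEMENT

The v4.2 composition of line `Sketch` (`…CompactAccess.lean` p167746, `…CompactOfStubs.lean` p167827) derives the crux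
`CensorshipAlongKerrEnds` from the registered physics stubs `stub_smoothCompactNakedExit` / `stub_smoothCompactCensoredExit` (the
summit's settled exits stmt-17383 / stmt-17348 in the weakest witness form: through the datum passes a SMOOTH one-parameter
COMPACTLY SUPPORTED deformation inside the admissible class whose small non-zero members are settled), the sibling crux E's
atom, the absorption, and three items.  This record makes the STRENGTH of the two exits explicit for the planners who are asked
to promote them: together with `MGHDExists` (stmt-9937) they imply `FinalStateConjecture` itself — through every non-settled
admissible datum they put (after the landed gauge-borne upgrade `compactSettledTameAccess_of_smoothCompactExits` and the landed
`stub_windowUpgrade`) a tame, injective, immersed curve of admissible data whose members off `0` are settled, i.e. exactly a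
witness of the summit's tame Christodoulou genericity.  So promoting them files a (localized, naked/censored-split) form of the
summit, as the exits 17383/17348 already are; the line's reduction of `CensorshipAlongKerrEnds` is "summit-type exits ∧ E's gluing
atom ∧ absorption", never below the summit's own WCC/settling content (lead c1's remark, now kernel-checked for the compact forms).
[cite: Christodoulou1999, p. A24]
-/

-- the summit-side namespace doubles the `FinalStateConjecture` path component by design
set_option linter.dupNamespace false

noncomputable section

open scoped Manifold ContDiff Topology
open Set Function Filter TopologicalSpace Literature.Geometry.Lorentzian
open Summit.FinalStateConjecture.FinalStateConjecture.Theses.ExactKerrEnds (MGHDExists)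
open Summit.FinalStateConjecture.FinalStateConjecture.Theorems.SwallowTheDatum.ParametricKerrBurial (AgreeAt)

namespace Summit.FinalStateConjecture.FinalStateConjecture.Theorems.ExactKerrEnds.CensorshipAlongKerrEnds

/-- **Registered record `finalStateConjecture_of_smoothCompactExits` of the crux item (stmt-FinalStateConjecture-18521): the two
smooth compact exits and MGHD existence imply the summit statement.**  Through a non-settled admissible datum `d`: compact settled
tame access (`compactSettledTameAccess_of_smoothCompactExits`: tame on an end, immersed at `0`, admissible members, settled on a
punctured window), then the landed window upgrade (`stub_windowUpgrade`: injective, settled for all `c ≠ 0`).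
[cite: Christodoulou1999, p. A24] -/
theorem finalStateConjecture_of_smoothCompactExits : (∀ (X : Type) [TopologicalSpace X] [ChartedSpace E3 X] [IsManifold (𝓡 3) ((⊤ : ℕ∞) : WithTop ℕ∞) X] [T2Space X] [SecondCountableTopology X] [ConnectedSpace X], ∀ D ∈ admissibleVacuumData X, (∃ 𝒟 : VacuumCauchyDevelopment D, 𝒟.IsMaximal ∧ ¬ HasCompleteNullInfinity 𝒟.toCauchyDevelopment) → ∃ F : EuclideanSpace ℝ (Fin 1) → InitialDataSet (𝓡 3) X, InitialDataSet.IsSmoothDataFamily 1 F ∧ F 0 = D ∧ (∀ c, F c ∈ admissibleVacuumData X) ∧ (∃ K : Set X, IsCompact K ∧ ∀ (c : EuclideanSpace ℝ (Fin 1)) (x : X), x ∉ K → (F c).h.inner x = D.h.inner x ∧ (F c).k x = D.k x) ∧ ∃ ε : ℝ, 0 < ε ∧ ∀ c, c ≠ 0 → ‖c‖ < ε → ((∃ 𝒟 : VacuumCauchyDevelopment (F c), 𝒟.IsMaximal) ∧ ∀ 𝒟 : VacuumCauchyDevelopment (F c), 𝒟.IsMaximal → HasCompleteNullInfinity 𝒟.toCauchyDevelopment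 ∧ ∃ (O : Set 𝒟.carrier) (dd : FinalStateDecomposition 𝒟.toSpacetime O 2), (∀ i, Kerr.IsSubextremal (dd.mass i) (dd.spin i)) ∧ O = exteriorOf 𝒟.toCauchyDevelopment dd.charted ∧ RaysStayInClosure 𝒟.toCauchyDevelopment O ∧ HasExhaustiveCharts dd ∧ IsFutureOriented dd)) → (∀ (X : Type) [TopologicalSpace X] [ChartedSpace E3 X] [IsManifold (𝓡 3) ((⊤ : ℕ∞) : WithTop ℕ∞) X] [T2Space X] [SecondCountableTopology X] [ConnectedSpace X], ∀ D ∈ admissibleVacuumData X, (∃ 𝒟 : VacuumCauchyDevelopment D, 𝒟.IsMaximal) → (∀ 𝒟 : VacuumCauchyDevelopment D, 𝒟.IsMaximal → HasCompleteNullInfinity 𝒟.toCauchyDevelopment) → (∃ 𝒟 : VacuumCauchyDevelopment D, 𝒟.IsMaximal ∧ ¬ ∃ (O : Set 𝒟.carrier) (dd : FinalStateDecomposition 𝒟.toSpacetime O 2), (∀ i, Kerr.IsSubextremal (dd.mass i) (dd.spin i)) ∧ O = exteriorOf 𝒟.toCauchyDevelopment dd.charted ∧ RaysStayInClosure 𝒟.toCauchyDevelopment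 O ∧ HasExhaustiveCharts dd ∧ IsFutureOriented dd) → ∃ F : EuclideanSpace ℝ (Fin 1) → InitialDataSet (𝓡 3) X, InitialDataSet.IsSmoothDataFamily 1 F ∧ F 0 = D ∧ (∀ c, F c ∈ admissibleVacuumData X) ∧ (∃ K : Set X, IsCompact K ∧ ∀ (c : EuclideanSpace ℝ (Fin 1)) (x : X), x ∉ K → (F c).h.inner x = D.h.inner x ∧ (F c).k x = D.k x) ∧ ∃ ε : ℝ, 0 < ε ∧ ∀ c, c ≠ 0 → ‖c‖ < ε → ((∃ 𝒟 : VacuumCauchyDevelopment (F c), 𝒟.IsMaximal) ∧ ∀ 𝒟 : VacuumCauchyDevelopment (F c), 𝒟.IsMaximal → HasCompleteNullInfinity 𝒟.toCauchyDevelopment ∧ ∃ (O : Set 𝒟.carrier) (dd : FinalStateDecomposition 𝒟.toSpacetime O 2), (∀ i, Kerr.IsSubextremal (dd.mass i) (dd.spin i)) ∧ O = exteriorOf 𝒟.toCauchyDevelopment dd.charted ∧ RaysStayInClosure 𝒟.toCauchyDevelopment O ∧ HasExhaustiveCharts dd ∧ IsFutureOriented dd)) → MGHDExists → FinalStateConjecture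 := by
  intro hN hT hM X _ _ _ _ _ _ d hd
  obtain ⟨hd𝓓, hdexc⟩ := hd
  obtain ⟨e, G, hGt, hGi, hG0, hGadm, -, ε, hε, hGset⟩ :=
    compactSettledTameAccess_of_smoothCompactExits hN hT hM X d hd𝓓
  obtain ⟨F', hF't, hF'0, hF'inj, hF'i, hF'P⟩ :=
    stub_windowUpgrade X (fun D ↦ D ∈ admissibleVacuumData X ∧
        ((∃ 𝒟 : VacuumCauchyDevelopment D, 𝒟.IsMaximal) ∧ ∀ 𝒟 : VacuumCauchyDevelopment D, 𝒟.IsMaximal →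
          HasCompleteNullInfinity 𝒟.toCauchyDevelopment ∧ ∃ (O : Set 𝒟.carrier) (dd : FinalStateDecomposition 𝒟.toSpacetime O 2),
            (∀ i, Kerr.IsSubextremal (dd.mass i) (dd.spin i)) ∧ O = exteriorOf 𝒟.toCauchyDevelopment dd.charted ∧
              RaysStayInClosure 𝒟.toCauchyDevelopment O ∧ HasExhaustiveCharts dd ∧ IsFutureOriented dd))
      e G hGt hGi ⟨ε, hε, fun c hc hcε ↦ ⟨hGadm c, hGset c hc hcε⟩⟩
  refine ⟨e, F', hF't, hF'i, hF'0.trans hG0, hF'inj, fun c ↦ ?_, fun c hc hmem ↦ hmem.2 (hF'P c hc).2⟩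
  by_cases hc : c = 0
  · subst hc; rw [hF'0, hG0]; exact hd𝓓
  · exact (hF'P c hc).1

end Summit.FinalStateConjecture.FinalStateConjecture.Theorems.ExactKerrEnds.CensorshipAlongKerrEnds

end
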